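import Summits.AtomisticToContinuum.HydrodynamicLimit.Theses.AnnealedZeroHorizon

/-!
# Strategy census (kernel-checked part) — crux `MeanFluxClosure` (stmt-AtomisticToContinuum-9256),
# route AnnealedZeroHorizon; seat planner-cstrat-stmt-AtomisticToContinuum-9256-s1-0, 2026-08-17.

Companion of `STRATEGY-CENSUS.md` (same crux directory).  Nothing here is a line or a stub; it types
the objects the census talks about and proves the cheap implications it claims:

* `EnergyPart` / `MomentumPart` — the two conjuncts of the crux under its common prefix, verbatim
  (`meanFluxClosure_iff` is `Iff.rfl`);
* `MeanFluxClosureTied` — the crux RESTRICTED to the instances the deciding theorem consumes: along a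
  classical hard-sphere Euler solution on `[0,T)`, under the Statement's packing guard, with the
  `t = 0` law of large numbers, for `0 ≤ t₁ ≤ t₂ < T` (the frame of `AnnealedWeakStrong` and of the
  re-typed Statement); `tied_of_meanFluxClosure : MeanFluxClosure → MeanFluxClosureTied` (the
  recommended restatement R is a pure weakening of the filed crux) and
  `annealedWeakStrong_of_tied` / `closes_after_R` (R keeps the route deciding: the same two-line glue);
* `MeanIsentropyTied` — the scalar "no mean thermodynamic-entropy production of the coarse-grained
  fields before the shock" (the reverse of `MeanSecondLaw`'s inequality, tied), the hard stub of the
  entropy-ledger reformulation discussed under ## Transfer / ## Decomposition of the census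
  (with `MeanSecondLaw`, the free Clausius direction, and isentropy of classical solutions in the
  analytic band — `integral_entropy_eq` of Theorems/JaynesSqueezeBlockGibbsToRelEntropyEntropyConservation — it pins `E S(t)` two-sidedly).

`lean check` rc 0, 0 sorries (2026-08-17, remote farm).  The audit classes `vendored-fact`/`orphan`
are expected: these are census objects, not items.
-/

namespace Summit.AtomisticToContinuum.HydrodynamicLimit.Cruxes.MeanFluxClosure.StrategyCensus

open Summit.AtomisticToContinuum.HydrodynamicLimit.Theses.AnnealedZeroHorizon

/-- ENERGY conjunct of the crux under the common prefix (verbatim): for every smooth scalar `ψ` a kernel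
radius `ℓ` such that for all admissible kernels, eventually in `N`, the pathwise energy defect over
`[t₁, t₂]` is integrable under the local Gibbs law with `|mean| ≤ ε`. -/
def EnergyPart (σ : ℝ) (a₀ θ₀ : Literature.MathematicalPhysics.KineticTheory.T3 → ℝ) (u₀ : Literature.MathematicalPhysics.KineticTheory.T3 → Literature.MathematicalPhysics.KineticTheory.V3) (Φ : (N : ℕ) → Literature.Analysis.FluidPDE.HardSphereFlow (Literature.Analysis.FluidPDE.Torus.geometry (Fin 3)) (Literature.MathematicalPhysics.KineticTheory.hsDiameter σ N) (N + 1)) (t₁ t₂ ε : ℝ) : Prop :=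
  (∀ ψ : Literature.MathematicalPhysics.KineticTheory.T3 → ℝ, Literature.Analysis.FunctionSpaces.Torus.IsSmooth ψ → ∃ ℓ : ℝ, 0 < ℓ ∧ ∀ k : Literature.MathematicalPhysics.KineticTheory.T3 → ℝ, (Continuous k ∧ (∀ y, 0 ≤ k y) ∧ (∫ y, k y = 1) ∧ (∀ y, k y ≠ 0 → Literature.Analysis.FluidPDE.Torus.euclidDist y 0 < ℓ)) → ∀ᶠ N in Filter.atTop, let D : Literature.Analysis.FluidPDE.Config (N + 1) (Fin 3) Literature.MathematicalPhysics.KineticTheory.T3 → ℝ := fun z => (Literature.MathematicalPhysics.KineticTheory.empiricalEnergyField ((Φ N).flow t₂ z) ψ - Literature.MathematicalPhysics.KineticTheory.empiricalEnergyField ((Φ N).flow t₁ z) ψ) - ∫ s in t₁..t₂, ∫ x, (let R : ℝ := Literature.MathematicalPhysics.KineticTheory.empiricalDensityField ((Φ N).flow s z) (fun y => k (x - y)); let Mv : Literature.MathematicalPhysics.KineticTheory.V3 := Literature.MathematicalPhysics.KineticTheory.empiricalMomentumField ((Φ N).flow s z) (fun y => k (x - y)); let En : ℝ := Literature.MathematicalPhysics.KineticTheory.empiricalEnergyField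 ((Φ N).flow s z) (fun y => k (x - y)); let Θ : ℝ := 2 / 3 * (En / R - ‖Mv‖ ^ 2 / (2 * R ^ 2)); let Pr : ℝ := Literature.MathematicalPhysics.KineticTheory.hsPressure σ R Θ; ((En + Pr) / R) * (∑ i, Mv i * Literature.Analysis.FunctionSpaces.Torus.partialDeriv i ψ x)); MeasureTheory.Integrable D (Literature.MathematicalPhysics.KineticTheory.localGibbsLaw σ a₀ u₀ θ₀ N (Φ N)) ∧ |∫ z, D z ∂Literature.MathematicalPhysics.KineticTheory.localGibbsLaw σ a₀ u₀ θ₀ N (Φ N)| ≤ ε)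

/-- MOMENTUM conjunct of the crux under the common prefix (verbatim). -/
def MomentumPart (σ : ℝ) (a₀ θ₀ : Literature.MathematicalPhysics.KineticTheory.T3 → ℝ) (u₀ : Literature.MathematicalPhysics.KineticTheory.T3 → Literature.MathematicalPhysics.KineticTheory.V3) (Φ : (N : ℕ) → Literature.Analysis.FluidPDE.HardSphereFlow (Literature.Analysis.FluidPDE.Torus.geometry (Fin 3)) (Literature.MathematicalPhysics.KineticTheory.hsDiameter σ N) (N + 1)) (t₁ t₂ ε : ℝ) : Prop :=
  (∀ φ : Literature.MathematicalPhysics.KineticTheory.T3 → Literature.MathematicalPhysics.KineticTheory.V3, Literature.Analysis.FunctionSpaces.Torus.IsSmooth φ → ∃ ℓ : ℝ, 0 < ℓ ∧ ∀ k : Literature.MathematicalPhysics.KineticTheory.T3 → ℝ, (Continuous k ∧ (∀ y, 0 ≤ k y) ∧ (∫ y, k y = 1) ∧ (∀ y, k y ≠ 0 → Literature.Analysis.FluidPDE.Torus.euclidDist y 0 < ℓ)) → ∀ᶠ N in Filter.atTop, let D : Literature.Analysis.FluidPDE.Config (N + 1) (Fin 3) Literature.MathematicalPhysics.KineticTheory.T3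 → ℝ := fun z => ((∑ i, (Literature.MathematicalPhysics.KineticTheory.empiricalMomentumField ((Φ N).flow t₂ z) (fun y => φ y i)) i) - (∑ i, (Literature.MathematicalPhysics.KineticTheory.empiricalMomentumField ((Φ N).flow t₁ z) (fun y => φ y i)) i)) - ∫ s in t₁..t₂, ∫ x, (let R : ℝ := Literature.MathematicalPhysics.KineticTheory.empiricalDensityField ((Φ N).flow s z) (fun y => k (x - y)); let Mv : Literature.MathematicalPhysics.KineticTheory.V3 := Literature.MathematicalPhysics.KineticTheory.empiricalMomentumField ((Φ N).flow s z) (fun y => k (x - y)); let En : ℝ := Literature.MathematicalPhysics.KineticTheory.empiricalEnergyField ((Φ N).flow s z) (fun y => k (x - y)); let Θ : ℝ := 2 / 3 * (En / R - ‖Mv‖ ^ 2 / (2 * R ^ 2)); let Pr : ℝ := Literature.MathematicalPhysics.KineticTheory.hsPressure σ R Θ; (∑ i, ∑ j, (Mv i * Mv j / R) * Literature.Analysis.FunctionSpaces.Torus.partialDeriv j (fun y => φ y i) x) + Pr * Literature.Analysis.FunctionSpaces.Torus.divergence φ x); MeasureTheory.Integrable D (Literature.MathematicalPhysics.KineticTheory.localGibbsLaw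 σ a₀ u₀ θ₀ N (Φ N)) ∧ |∫ z, D z ∂Literature.MathematicalPhysics.KineticTheory.localGibbsLaw σ a₀ u₀ θ₀ N (Φ N)| ≤ ε)

/-- The crux is, definitionally, its common prefix followed by `EnergyPart ∧ MomentumPart`. -/
theorem meanFluxClosure_iff : MeanFluxClosure ↔
    (∀ (a₀ θ₀ : Literature.MathematicalPhysics.KineticTheory.T3 → ℝ) (u₀ : Literature.MathematicalPhysics.KineticTheory.T3 → Literature.MathematicalPhysics.KineticTheory.V3), Continuous a₀ → Continuous θ₀ → Continuous u₀ → (∀ x, 0 < a₀ x) → (∀ x, 0 < θ₀ x) → ∃ σ₀ : ℝ, 0 < σ₀ ∧ ∀ σ : ℝ, 0 < σ → σ < σ₀ → ∀ Φ : (N : ℕ) → Literature.Analysis.FluidPDE.HardSphereFlow (Literature.Analysis.FluidPDE.Torus.geometry (Fin 3)) (Literature.MathematicalPhysics.KineticTheory.hsDiameter σ N) (N + 1), ∀ t₁ t₂ : ℝ, 0 ≤ t₁ → t₁ ≤ t₂ → ∀ ε : ℝ, 0 < ε → EnergyPart σ a₀ θ₀ u₀ Φ t₁ t₂ ε ∧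 MomentumPart σ a₀ θ₀ u₀ Φ t₁ t₂ ε) :=
  Iff.rfl

/-- **Restatement R (recommended to tenure, NOT filed by this seat): the crux tied to its use.**
Same two defects, same kernels, same `|mean| ≤ ε`, but only for the instances `closes` consumes through
`AnnealedWeakStrong`: an outermost packing threshold `η₁`, a classical hard-sphere Euler solution
`(ρ,u,θ)` on `[0,T)` whose packing stays below `η₁`, a flow family whose local-Gibbs fields converge to
the solution's data at `t = 0`, and times `0 ≤ t₁ ≤ t₂ < T`.  The surplus of the filed crux over this
(rough continuous profiles with no classical solution; `t₂` beyond every classical time) is unused by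
`closes` and unreachable by every entropy mechanism (census ## Negation N1, ## Transfer T2/T6). -/
def MeanFluxClosureTied : Prop :=
  ∃ η₁ : ℝ, 0 < η₁ ∧ ∀ (a₀ θ₀ : Literature.MathematicalPhysics.KineticTheory.T3 → ℝ) (u₀ : Literature.MathematicalPhysics.KineticTheory.T3 → Literature.MathematicalPhysics.KineticTheory.V3), Continuous a₀ → Continuous θ₀ → Continuous u₀ → (∀ x, 0 < a₀ x) → (∀ x, 0 < θ₀ x) → ∃ σ₀ : ℝ, 0 < σ₀ ∧ ∀ σ : ℝ, 0 < σ → σ < σ₀ → ∀ (T : ℝ) (ρ θ : ℝ → Literature.MathematicalPhysics.KineticTheory.T3 → ℝ) (u : ℝ → Literature.MathematicalPhysics.KineticTheory.T3 → Literature.MathematicalPhysics.KineticTheory.V3), Literature.MathematicalPhysics.KineticTheory.IsHardSphereEulerSolution σ T ρ u θ → (∀ t ∈ Set.Ico 0 T, ∀ x, ρ t x * σ ^ 3 < η₁) → ∀ Φ : (N : ℕ) → Literature.Analysis.FluidPDE.HardSphereFlow (Literature.Analysis.FluidPDE.Torus.geometry (Fin 3)) (Literature.MathematicalPhysics.KineticTheory.hsDiameter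 σ N) (N + 1), Literature.MathematicalPhysics.KineticTheory.TendstoHydroFieldsAt (fun N => Literature.MathematicalPhysics.KineticTheory.localGibbsLaw σ a₀ u₀ θ₀ N (Φ N)) Φ ρ u θ 0 → ∀ t₁ t₂ : ℝ, 0 ≤ t₁ → t₁ ≤ t₂ → t₂ < T → ∀ ε : ℝ, 0 < ε → EnergyPart σ a₀ θ₀ u₀ Φ t₁ t₂ ε ∧ MomentumPart σ a₀ θ₀ u₀ Φ t₁ t₂ ε

/-- R is a pure weakening: the filed crux implies the tied crux (ignore solution, guard and LLN). -/
theorem tied_of_meanFluxClosure (h : MeanFluxClosure) : MeanFluxClosureTied := by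
  refine ⟨1, one_pos, fun a₀ θ₀ u₀ ha hθ hu hap hθp => ?_⟩
  obtain ⟨σ₀, hσ₀, H⟩ := h a₀ θ₀ u₀ ha hθ hu hap hθp
  refine ⟨σ₀, hσ₀, fun σ hσ hσ' T ρ θ u _ _ Φ _ t₁ t₂ h₁ h₁₂ _ ε hε => ?_⟩
  exact H σ hσ hσ' Φ t₁ t₂ h₁ h₁₂ ε hε

/-- `AnnealedWeakStrong` with its first hypothesis weakened to the tied crux (the companion restatement
of item 9258 under R; its conclusion is still VERBATIM the Statement body). -/
def AnnealedWeakStrongTied : Prop :=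
  MeanFluxClosureTied → MeanSecondLaw → ∃ η₀ : ℝ, 0 < η₀ ∧ ∀ (a₀ θ₀ : Literature.MathematicalPhysics.KineticTheory.T3 → ℝ) (u₀ : Literature.MathematicalPhysics.KineticTheory.T3 → Literature.MathematicalPhysics.KineticTheory.V3), Continuous a₀ → Continuous θ₀ → Continuous u₀ → (∀ x, 0 < a₀ x) → (∀ x, 0 < θ₀ x) → ∃ σ₀ : ℝ, 0 < σ₀ ∧ ∀ σ : ℝ, 0 < σ → σ < σ₀ → ∀ (T : ℝ) (ρ θ : ℝ → Literature.MathematicalPhysics.KineticTheory.T3 → ℝ) (u : ℝ → Literature.MathematicalPhysics.KineticTheory.T3 → Literature.MathematicalPhysics.KineticTheory.V3), Literature.MathematicalPhysics.KineticTheory.IsHardSphereEulerSolution σ T ρ u θ → (∀ t ∈ Set.Ico 0 T, ∀ x, ρ t x * σ ^ 3 < η₀) → ∀ Φ : (N : ℕ) → Literature.Analysis.FluidPDE.HardSphereFlow (Literature.Analysis.FluidPDE.Torus.geometry (Fin 3)) (Literature.MathematicalPhysics.KineticTheory.hsDiameter σ N) (N + 1), Literature.MathematicalPhysics.KineticTheory.TendstoHydroFieldsAt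 (fun N => Literature.MathematicalPhysics.KineticTheory.localGibbsLaw σ a₀ u₀ θ₀ N (Φ N)) Φ ρ u θ 0 → ∀ t ∈ Set.Ico 0 T, Literature.MathematicalPhysics.KineticTheory.TendstoHydroFieldsAt (fun N => Literature.MathematicalPhysics.KineticTheory.localGibbsLaw σ a₀ u₀ θ₀ N (Φ N)) Φ ρ u θ t

/-- The tied weak–strong item is the stronger implication: it gives back the filed one. -/
theorem annealedWeakStrong_of_tied (h : AnnealedWeakStrongTied) : AnnealedWeakStrong :=
  fun hM hS => h (tied_of_meanFluxClosure hM) hS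

/-- After R the route still decides the Statement by the same term (`closes` survives verbatim in shape). -/
theorem closes_after_R (hMFC : MeanFluxClosureTied) (hMSL : MeanSecondLaw) (hAWS : AnnealedWeakStrongTied) :
    HydrodynamicLimit :=
  hAWS hMFC hMSL

/-- **K1′ — mean isentropy of the coarse-grained fields before the shock (tied).** Along a guarded
classical solution with the `t = 0` LLN, for `t < T`: the law-averaged coarse-grained mathematical
entropy `E ∫ η_σ(ρ^k, m^k, E^k)(x) dx` of the time-`t` configuration (the functional of `MeanSecondLaw`)
is at least the Euler entropy `∫ η_σ(U(t)) dx − ε` (`= ∫ η_σ(U(0)) dx − ε`, classical solutions being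
isentropic in the analytic band).  With `MeanSecondLaw` (the free Clausius direction) it pins
`E ∫ η_σ(U^k_N(t)) = ∫ η_σ(U(t)) + o(1)`; by Liouville + the chain rule this is `o(N)` conditional
relative entropy of the evolved law given its coarse-grained fields (the entropy ledger), which closes
the QUADRATIC (kinetic-stress) part of the tied crux in mean by the entropy inequality.  Weaker than
`JaynesSqueeze.NoMeanEntropyProduction` (entropy of the MEAN block profile) by Jensen.  Open-problem
class (it is the conjunct's dissipative content in scalar form); recorded as a signature, not filed. -/
def MeanIsentropyTied : Prop :=
  ∃ η₁ : ℝ, 0 < η₁ ∧ ∀ (a₀ θ₀ : Literature.MathematicalPhysics.KineticTheory.T3 → ℝ) (u₀ : Literature.MathematicalPhysics.KineticTheory.T3 → Literature.MathematicalPhysics.KineticTheory.V3), Continuous a₀ → Continuous θ₀ → Continuous u₀ → (∀ x, 0 < a₀ x) → (∀ x, 0 < θ₀ x) → ∃ σ₀ : ℝ, 0 < σ₀ ∧ ∀ σ : ℝ, 0 < σ → σ < σ₀ → ∀ (T : ℝ) (ρ θ : ℝ → Literature.MathematicalPhysics.KineticTheory.T3 → ℝ) (u : ℝ → Literature.MathematicalPhysics.KineticTheory.T3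 → Literature.MathematicalPhysics.KineticTheory.V3), Literature.MathematicalPhysics.KineticTheory.IsHardSphereEulerSolution σ T ρ u θ → (∀ t ∈ Set.Ico 0 T, ∀ x, ρ t x * σ ^ 3 < η₁) → ∀ Φ : (N : ℕ) → Literature.Analysis.FluidPDE.HardSphereFlow (Literature.Analysis.FluidPDE.Torus.geometry (Fin 3)) (Literature.MathematicalPhysics.KineticTheory.hsDiameter σ N) (N + 1), Literature.MathematicalPhysics.KineticTheory.TendstoHydroFieldsAt (fun N => Literature.MathematicalPhysics.KineticTheory.localGibbsLaw σ a₀ u₀ θ₀ N (Φ N)) Φ ρ u θ 0 → ∀ t : ℝ, 0 ≤ t → t < T → ∀ ε : ℝ, 0 < ε → ∃ ℓ : ℝ, 0 < ℓ ∧ ∀ k : Literature.MathematicalPhysics.KineticTheory.T3 → ℝ, (Continuous k ∧ (∀ y, 0 ≤ k y) ∧ (∫ y, k y = 1) ∧ (∀ y, k y ≠ 0 → Literature.Analysis.FluidPDE.Torus.euclidDist y 0 < ℓ)) → ∀ᶠ N in Filter.atTop, let S : Literature.Analysis.FluidPDE.Config (N + 1) (Fin 3) Literature.MathematicalPhysics.KineticTheory.T3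 → ℝ := fun z => ∫ x, (let R : ℝ := Literature.MathematicalPhysics.KineticTheory.empiricalDensityField ((Φ N).flow t z) (fun y => k (x - y)); let Mv : Literature.MathematicalPhysics.KineticTheory.V3 := Literature.MathematicalPhysics.KineticTheory.empiricalMomentumField ((Φ N).flow t z) (fun y => k (x - y)); let En : ℝ := Literature.MathematicalPhysics.KineticTheory.empiricalEnergyField ((Φ N).flow t z) (fun y => k (x - y)); let Θ : ℝ := 2 / 3 * (En / R - ‖Mv‖ ^ 2 / (2 * R ^ 2)); -(R * (3 / 2 * Real.log Θ - Real.log R - Literature.MathematicalPhysics.KineticTheory.hsExcessFreeEnergy (R * σ ^ 3)))); MeasureTheory.Integrable S (Literature.MathematicalPhysics.KineticTheory.localGibbsLaw σ a₀ u₀ θ₀ N (Φ N)) ∧ (∫ x, -((ρ t x) * (3 / 2 * Real.log (2 / 3 * ((Literature.MathematicalPhysics.KineticTheory.totalEnergyDensity (ρ t x) (u t x) (θ t x)) / (ρ t x) - ‖(ρ t x) • u t x‖ ^ 2 / (2 * (ρ t x) ^ 2))) - Real.log (ρ t x) - Literature.MathematicalPhysics.KineticTheory.hsExcessFreeEnergy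 ((ρ t x) * σ ^ 3)))) - ε ≤ ∫ z, S z ∂Literature.MathematicalPhysics.KineticTheory.localGibbsLaw σ a₀ u₀ θ₀ N (Φ N)

end Summit.AtomisticToContinuum.HydrodynamicLimit.Cruxes.MeanFluxClosure.StrategyCensus
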